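import Literature.MathematicalPhysics.QuantumLattice.WilsonLoopsProofs
import Literature.MathematicalPhysics.QuantumFieldTheory.LatticeGaugeAsymptoticsCornerEdges
import HarnessLib

/-!
# Venture YMGap, track ROBUST-BALL — edge sets of straight walks and rectangles on `ℤ^d`

HONEST FRAMING. WHAT THIS IS: a venture file (cell `pub-ymgap`, track Y2 ROBUST-BALL, seat rb-p1), elementary
lattice geometry feeding the rectangle-family member of the loop-action norm ball (`RectangleLoopFamily.lean`): the
edge set (tree `walkEdges`) of a concatenation / reversal / copy, of a straight walk `lineWalk i n x`
(`(x + k e_i, i)`, `k < n`) and of a rectangle `rectWalk x i j R T` (its four sides); consequences: base points of the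
links of a rectangle are `x + a e_i + b e_j` (`a ≤ R`, `b ≤ T`), two links of one rectangle are within
`ℓ^∞`-distance `R + T`, at most `2(R+T)` rectangles of a given plane and size pass through a given link, and a
rectangle has at least `R` (resp. `T`) distinct links. WHAT IT IS NOT: no measure, no gauge field, no number;
nothing about the continuum limit or the Clay problem.

References: rectangles and straight walks are the tree's (`QuantumLattice/WilsonLoops.lean`, after Wilson 1974 and
Seiler LNP 159 §2). [folklore]
-/

noncomputable section

open Function SimpleGraph
open Literature.Probability.LatticeModels
open Literature.MathematicalPhysics.QuantumLattice
open Literature.MathematicalPhysics.QuantumFieldTheory (walkEdges)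

namespace Summit.Ventures.YMGap.RobustBall

variable {d : ℕ}

/-! ### Edge sets of walks: concatenation, reversal, straight walks, rectangles -/

section Edges

/-- The trivial walk has no edges. -/
theorem walkEdges_nil (x : Site d) : walkEdges (Walk.nil : (zdGraph d).Walk x x) = ∅ := by
  unfold walkEdges; simp

/-- The edge set of a walk extended by a first dart. -/
theorem walkEdges_cons {x y z : Site d} (h : (zdGraph d).Adj x y) (p : (zdGraph d).Walk y z) :
    walkEdges (Walk.cons h p) = insert (dartStep ⟨(x, y), h⟩).1 (walkEdges p) := by
  unfold walkEdges
  rw [Walk.darts_cons, List.map_cons, List.toFinset_cons]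

/-- `Walk.copy` does not change the edge set. -/
theorem walkEdges_copy {x y x' y' : Site d} (p : (zdGraph d).Walk x y) (hx : x = x') (hy : y = y') :
    walkEdges (p.copy hx hy) = walkEdges p := by
  subst hx hy; rfl

/-- The edge set of a concatenation is the union of the edge sets. -/
theorem walkEdges_append {x y z : Site d} (p : (zdGraph d).Walk x y) (q : (zdGraph d).Walk y z) :
    walkEdges (p.append q) = walkEdges p ∪ walkEdges q := by
  unfold walkEdges
  rw [Walk.darts_append, List.map_append, List.toFinset_append]

/-- Reversal does not change the edge set. -/
theorem walkEdges_reverse {x y : Site d} (p : (zdGraph d).Walk x y) : walkEdges p.reverse = walkEdges p := by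
  unfold walkEdges
  rw [Walk.darts_reverse, List.map_reverse, List.toFinset_reverse, List.map_map]
  congr 1
  exact List.map_congr_left fun a _ => by simp [dartStep_symm]

/-- **Edges of a straight walk**: `(x + k e_i, i)` for `k < n`. -/
theorem mem_walkEdges_lineWalk_iff (i : Fin d) :
    ∀ (n : ℕ) (x : Site d) (e : ZdEdge d),
      e ∈ walkEdges (lineWalk i n x) ↔ ∃ k : ℕ, k < n ∧ e = (x + Pi.single i (k : ℤ), i)
  | 0, x, e => by simp [lineWalk, walkEdges_copy, walkEdges_nil]
  | n + 1, x, e => by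
    rw [lineWalk, walkEdges_cons, walkEdges_copy, Finset.mem_insert, dartStep_add_single,
      mem_walkEdges_lineWalk_iff i n]
    constructor
    · rintro (h | ⟨k, hk, h⟩)
      · exact ⟨0, Nat.succ_pos n, by rw [h]; simp⟩
      · refine ⟨k + 1, by omega, ?_⟩
        rw [h, add_assoc, ← Pi.single_add]
        push_cast
        rw [add_comm (1 : ℤ)]
    · rintro ⟨k, hk, h⟩
      rcases k with _ | k
      · exact Or.inl (by rw [h]; simp)
      · refine Or.inr ⟨k, by omega, ?_⟩
        rw [h, add_assoc, ← Pi.single_add]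
        push_cast
        rw [add_comm (1 : ℤ)]

/-- **Edges of a rectangle** `rectWalk x i j R T`: the four sides. -/
theorem mem_walkEdges_rectWalk_iff (x : Site d) (i j : Fin d) (R T : ℕ) (e : ZdEdge d) :
    e ∈ walkEdges (rectWalk x i j R T) ↔
      (∃ k : ℕ, k < R ∧ e = (x + Pi.single i (k : ℤ), i)) ∨
      (∃ k : ℕ, k < T ∧ e = (x + Pi.single i (R : ℤ) + Pi.single j (k : ℤ), j)) ∨
      (∃ k : ℕ, k < R ∧ e = (x + Pi.single j (T : ℤ) + Pi.single i (k : ℤ), i)) ∨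
      (∃ k : ℕ, k < T ∧ e = (x + Pi.single j (k : ℤ), j)) := by
  rw [rectWalk, walkEdges_append, walkEdges_append, walkEdges_append, walkEdges_copy, walkEdges_reverse,
    walkEdges_reverse, Finset.mem_union, Finset.mem_union, Finset.mem_union, mem_walkEdges_lineWalk_iff,
    mem_walkEdges_lineWalk_iff, mem_walkEdges_lineWalk_iff, mem_walkEdges_lineWalk_iff]

/-- Base points of the links of a rectangle: `x + a e_i + b e_j` with `a ≤ R`, `b ≤ T`. -/
theorem exists_offsets_of_mem_walkEdges_rectWalk {x : Site d} {i j : Fin d} {R T : ℕ} {e : ZdEdge d}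
    (he : e ∈ walkEdges (rectWalk x i j R T)) :
    ∃ a b : ℕ, a ≤ R ∧ b ≤ T ∧ e.1 = x + Pi.single i (a : ℤ) + Pi.single j (b : ℤ) := by
  rw [mem_walkEdges_rectWalk_iff] at he
  rcases he with ⟨k, hk, rfl⟩ | ⟨k, hk, rfl⟩ | ⟨k, hk, rfl⟩ | ⟨k, hk, rfl⟩
  · exact ⟨k, 0, hk.le, Nat.zero_le _, by simp⟩
  · exact ⟨R, k, le_rfl, hk.le, rfl⟩
  · exact ⟨k, T, hk.le, le_rfl, by simp only; rw [add_right_comm]⟩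
  · exact ⟨0, k, Nat.zero_le _, hk.le, by simp⟩

/-- **Links of one rectangle are `ℓ^∞`-close**: `‖e − y‖_∞ ≤ R + T`. -/
theorem norm_sub_le_of_mem_walkEdges_rectWalk {x : Site d} {i j : Fin d} {R T : ℕ} {e y : ZdEdge d}
    (he : e ∈ walkEdges (rectWalk x i j R T)) (hy : y ∈ walkEdges (rectWalk x i j R T)) :
    ‖e.1 - y.1‖ ≤ (R : ℝ) + T := by
  obtain ⟨a, b, ha, hb, hae⟩ := exists_offsets_of_mem_walkEdges_rectWalk he
  obtain ⟨a', b', ha', hb', hay⟩ := exists_offsets_of_mem_walkEdges_rectWalk hy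
  have hdiff : e.1 - y.1 = Pi.single i ((a : ℤ) - a') + Pi.single j ((b : ℤ) - b') := by
    rw [hae, hay, Pi.single_sub, Pi.single_sub]; abel
  rw [hdiff]
  have haR : (a : ℝ) ≤ R := by exact_mod_cast ha
  have haR' : (a' : ℝ) ≤ R := by exact_mod_cast ha'
  have hbT : (b : ℝ) ≤ T := by exact_mod_cast hb
  have hbT' : (b' : ℝ) ≤ T := by exact_mod_cast hb'
  refine (norm_add_le _ _).trans (add_le_add ?_ ?_)
  · rw [Pi.norm_single, Int.norm_eq_abs]
    push_cast
    rw [abs_sub_le_iff]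
    constructor <;> linarith [Nat.cast_nonneg (α := ℝ) a, Nat.cast_nonneg (α := ℝ) a']
  · rw [Pi.norm_single, Int.norm_eq_abs]
    push_cast
    rw [abs_sub_le_iff]
    constructor <;> linarith [Nat.cast_nonneg (α := ℝ) b, Nat.cast_nonneg (α := ℝ) b']

/-- **At most `2(R+T)` rectangles of a given plane and size pass through a link**: the base points of the
rectangles `rectWalk x i j R T` containing the link `e` lie in an explicit set of at most `2(R+T)` sites. -/
theorem exists_bases_of_mem_walkEdges_rectWalk (e : ZdEdge d) (i j : Fin d) (R T : ℕ) :
    ∃ S : Finset (Site d), S.card ≤ 2 * (R + T) ∧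
      ∀ x : Site d, e ∈ walkEdges (rectWalk x i j R T) → x ∈ S := by
  classical
  set A := (Finset.range R).image (fun k : ℕ => e.1 - Pi.single i (k : ℤ)) with hA
  set B := (Finset.range T).image (fun k : ℕ => e.1 - Pi.single j (k : ℤ) - Pi.single i (R : ℤ)) with hB
  set C := (Finset.range R).image (fun k : ℕ => e.1 - Pi.single i (k : ℤ) - Pi.single j (T : ℤ)) with hC
  set D := (Finset.range T).image (fun k : ℕ => e.1 - Pi.single j (k : ℤ)) with hD
  refine ⟨A ∪ B ∪ C ∪ D, ?_, fun x hx => ?_⟩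
  · have h1 : A.card ≤ R := Finset.card_image_le.trans (Finset.card_range R).le
    have h2 : B.card ≤ T := Finset.card_image_le.trans (Finset.card_range T).le
    have h3 : C.card ≤ R := Finset.card_image_le.trans (Finset.card_range R).le
    have h4 : D.card ≤ T := Finset.card_image_le.trans (Finset.card_range T).le
    calc (A ∪ B ∪ C ∪ D).card ≤ (A ∪ B ∪ C).card + D.card := Finset.card_union_le _ _
      _ ≤ (A ∪ B).card + C.card + D.card := Nat.add_le_add_right (Finset.card_union_le _ _) _
      _ ≤ A.card + B.card + C.card + D.card :=
          Nat.add_le_add_right (Nat.add_le_add_right (Finset.card_union_le _ _) _) _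
      _ ≤ 2 * (R + T) := by omega
  · rw [mem_walkEdges_rectWalk_iff] at hx
    simp only [hA, hB, hC, hD, Finset.mem_union, Finset.mem_image, Finset.mem_range]
    rcases hx with ⟨k, hk, rfl⟩ | ⟨k, hk, rfl⟩ | ⟨k, hk, rfl⟩ | ⟨k, hk, rfl⟩
    · exact Or.inl (Or.inl (Or.inl ⟨k, hk, by simp⟩))
    · exact Or.inl (Or.inl (Or.inr ⟨k, hk, by simp only; abel⟩))
    · exact Or.inl (Or.inr ⟨k, hk, by simp only; abel⟩)
    · exact Or.inr ⟨k, hk, by simp⟩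

/-- The `m + 1` bottom links of a rectangle are distinct members of its edge set: `m + 1 ≤ |edges|`. -/
theorem succ_le_card_walkEdges_rectWalk_fst (x : Site d) (i j : Fin d) (m T : ℕ) :
    m + 1 ≤ (walkEdges (rectWalk x i j (m + 1) T)).card := by
  classical
  have hsub : (Finset.range (m + 1)).image (fun k : ℕ => ((x + Pi.single i (k : ℤ), i) : ZdEdge d)) ⊆
      walkEdges (rectWalk x i j (m + 1) T) := by
    intro e he
    rw [Finset.mem_image] at he
    obtain ⟨k, hk, rfl⟩ := he
    rw [mem_walkEdges_rectWalk_iff]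
    exact Or.inl ⟨k, Finset.mem_range.1 hk, rfl⟩
  have hinj : Function.Injective (fun k : ℕ => ((x + Pi.single i (k : ℤ), i) : ZdEdge d)) := by
    intro k k' h
    have h1 := congrArg (fun e : ZdEdge d => e.1 i) h
    simp only [Pi.add_apply, Pi.single_eq_same, add_right_inj, Nat.cast_inj] at h1
    exact h1
  have h := Finset.card_le_card hsub
  rwa [Finset.card_image_of_injective _ hinj, Finset.card_range] at h

/-- The `n + 1` right links likewise: `n + 1 ≤ |edges|`. -/
theorem succ_le_card_walkEdges_rectWalk_snd (x : Site d) (i j : Fin d) (R n : ℕ) :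
    n + 1 ≤ (walkEdges (rectWalk x i j R (n + 1))).card := by
  classical
  have hsub : (Finset.range (n + 1)).image
      (fun k : ℕ => ((x + Pi.single i (R : ℤ) + Pi.single j (k : ℤ), j) : ZdEdge d)) ⊆
      walkEdges (rectWalk x i j R (n + 1)) := by
    intro e he
    rw [Finset.mem_image] at he
    obtain ⟨k, hk, rfl⟩ := he
    rw [mem_walkEdges_rectWalk_iff]
    exact Or.inr (Or.inl ⟨k, Finset.mem_range.1 hk, rfl⟩)
  have hinj : Function.Injective
      (fun k : ℕ => ((x + Pi.single i (R : ℤ) + Pi.single j (k : ℤ), j) : ZdEdge d)) := by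
    intro k k' h
    have h1 := congrArg (fun e : ZdEdge d => e.1 j) h
    simp only [Pi.add_apply, Pi.single_eq_same, add_right_inj, Nat.cast_inj] at h1
    exact h1
  have h := Finset.card_le_card hsub
  rwa [Finset.card_image_of_injective _ hinj, Finset.card_range] at h

end Edges

end Summit.Ventures.YMGap.RobustBall

end
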